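import Summits.RiemannHypothesis.RiemannHypothesis.Theorems.WeilCombCombShapePositivityMertensE1
import Summits.RiemannHypothesis.RiemannHypothesis.Theorems.WeilCombCombShapePositivityMertensMidrange
import Summits.RiemannHypothesis.RiemannHypothesis.Theorems.WeilCombCombShapePositivityMertensSmall
import HarnessLib

/-!
# The Mertens remainder for ALL `y`: `Σ_{n ≤ y} Λ(n)/n ≤ log y − γ + 9/100` (`y ≥ 20`) and the
# Mertens gain `Σ_{n ≤ y} Λ(n)/n ≤ log y − (log 2)/2` (`y ≥ 2`); the sharp Helson potential
# (STUB-PLAN `stub_windowCore`, helper A5; stub `stub_mertensGain`)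

Crux `WeilComb.CombShapePositivity` (item stmt-RiemannHypothesis-11229), line `Sketch`. Assembly of the
three range files of STUB-PLAN `stub_windowCore` Phase A — `…MertensE1` (`x ≥ 442439`:
`|E₁| ≤ 0.0185`, from the zeros of `ζ`), `…MertensMidrange` (`[319, 442439]`: `E₁ < 1/(2 log x) ≤ 0.0868`,
the kernel-certified (3.22)-chain), `…MertensSmall` (`[20, 319)`: `E₁ ≤ 9/100`, kernel fixed point) —
into M-uniform statements, `E₁(y) = ψ₁(y) − log y + γ`, `ψ₁(y) = Σ_{n ≤ y} Λ(n)/n`: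

* `sum_vonMangoldt_div_le_of_twenty_le` — **`ψ₁(y) ≤ log y − γ + 9/100` for every real `y ≥ 20`**
  (hypothesis-free; this is the two-sided-precision Mertens input "A2 + A3 + A4" of the plan, upper side);
* `sum_vonMangoldt_div_le_tiny_nat` — `ψ₁(N) ≤ log N − (log 2)/2` for `3 ≤ N ≤ 19` (a 17-step kernel run of
  the checker of `…MertensSmall` with the comparison `2P + L2HIN ≤ 2 lo(n)`);
* `stub_mertensGain` (registered on the crux) — **`ψ₁(y) ≤ log y − (log 2)/2` for every real `y ≥ 2`**
  (equality at `y = 2`): the "Mertens gain `c(y) = log y − ψ₁(y) ≥ (log 2)/2`" that lead c3's crux notes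
  (NOTES-c3 §3 (A)) record as blocked on the named fact `RosserSchoenfeld1962_eq_3_22` — it is not: the
  tree's certified chain, its 2000 zeros and Ford's `Σ 1/|ρ|²` bound suffice;
* the sharp Helson potential (A5), pointwise in the divisor variable: for `1 ≤ m ≤ M`,
  `log m + ψ₁(M/m) ≤ log M − (log 2)/2` if `2m ≤ M` (`potential_le_of_two_mul_le`) and
  `≤ log M − γ + 9/100` if `20m ≤ M` (`potential_le_of_twenty_mul_le`); the unrestricted `≤ log M` is the
  tree's `WeilCombHelsonGK7.log_add_sum_vonMangoldt_div_le_log`.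
-/

-- the sub-problem path RiemannHypothesis/RiemannHypothesis duplicates a namespace (D-0017)
set_option linter.dupNamespace false

open Finset ArithmeticFunction

namespace Summit.RiemannHypothesis.RiemannHypothesis.Theorems.WeilCombMertensAll

open Literature.NumberTheory.LFunctions Literature.Analysis.SpecialFunctions.KernelLog
open ChainCheck (L2HIN le_L2HIN)
open WeilCombMertensSmall (incr incr_sound psiOneNat psiOneNat_succ)

/-! ### `y ≥ 20`: the three ranges glued -/

/-- **`Σ_{n ≤ y} Λ(n)/n ≤ log y − γ + 9/100` for every real `y ≥ 20`** (small range by kernel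
computation, mid range by the certified (3.22)-chain, tail by the zeros of `ζ`). The constant is sharp to
`4·10⁻³` (`E₁(31) = 0.0864`); beyond `319` the bound is `0.0868`, beyond `442439` it is `0.0185`.
[cite: RosserSchoenfeld1962, Thm. 6 and Lemma 7] -/
theorem sum_vonMangoldt_div_le_of_twenty_le {y : ℝ} (hy : 20 ≤ y) :
    ∑ n ∈ Finset.Icc 1 ⌊y⌋₊, (Λ n : ℝ) / n ≤ Real.log y - Real.eulerMascheroniConstant + 9 / 100 := by
  rcases lt_or_ge y 319 with h1 | h1
  · exact WeilCombMertensSmall.stub_mertensSmall y hy h1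
  rcases le_or_gt y 442439 with h2 | h2
  · have h := WeilCombMertensMidrange.psiOne_lt_midrange h1 h2
    have h' := WeilCombMertensMidrange.one_div_two_log_le h1
    linarith
  · have h := WeilCombMertensE1.abs_mertensRemainder_le_of_ge h2.le
    have h' := (abs_le.1 h).2
    linarith

/-- The same over the naturals: `Σ_{n ≤ N} Λ(n)/n ≤ log N − γ + 9/100` for `N ≥ 20`.
[cite: RosserSchoenfeld1962, Thm. 6 and Lemma 7] -/
theorem sum_vonMangoldt_div_le_of_twenty_le_nat {N : ℕ} (hN : 20 ≤ N) :
    ∑ n ∈ Finset.Icc 1 N, (Λ n : ℝ) / n ≤ Real.log N - Real.eulerMascheroniConstant + 9 / 100 := by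
  have h := sum_vonMangoldt_div_le_of_twenty_le (y := (N : ℝ)) (by exact_mod_cast hN)
  rwa [Nat.floor_natCast] at h

/-! ### `3 ≤ N ≤ 19`: a 17-step kernel run with the threshold `(log 2)/2` -/

/-- The test at `n ≥ 3`: `2P + L2HIN ≤ 2 lo(n)` (`L2HIN ≥ 2⁸⁰ log 2`, `lo(n) ≤ 2⁸⁰ log n`). [folklore] -/
def stepOK2 (n P : ℕ) : Bool :=
  if 3 ≤ n then
    match logIv n with
    | some (lg, _) => decide (((2 * P + L2HIN : ℕ) : ℤ) ≤ 2 * lg)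
    | none => false
  else true

/-- The run with the test `stepOK2` (increments `incr` of `…MertensSmall`). [folklore] -/
def tinyRun : ℕ → ℕ → ℕ → Bool
  | 0, _, _ => true
  | fuel + 1, n, P =>
    match incr (n + 1) with
    | none => false
    | some d => stepOK2 (n + 1) (P + d) && tinyRun fuel (n + 1) (P + d)

/-- The certified run over `1 ≤ n ≤ 19`. [folklore] -/
theorem tinyRun_holds : tinyRun 19 0 0 = true := by
  decide +kernel

/-- Soundness of `stepOK2`: for `n ≥ 3`, `stepOK2 n P = true` and `2⁸⁰ ψ₁(n) ≤ P` give
`ψ₁(n) ≤ log n − (log 2)/2`. [folklore] -/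
theorem stepOK2_sound {n P : ℕ} (hn : 3 ≤ n) (h : stepOK2 n P = true) (hP : 2 ^ 80 * psiOneNat n ≤ P) :
    psiOneNat n ≤ Real.log n - Real.log 2 / 2 := by
  unfold stepOK2 at h
  rw [if_pos hn] at h
  revert h
  cases hl : logIv n with
  | none => simp
  | some lohi =>
    obtain ⟨lo, hi⟩ := lohi
    intro h
    have hdec : ((2 * P + L2HIN : ℕ) : ℤ) ≤ 2 * lo := of_decide_eq_true h
    have hlo := (logIv_sound hl).1
    have h2 := le_L2HIN
    have hR : 2 * (P : ℝ) + L2HIN ≤ 2 * (lo : ℝ) := by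
      have : (((2 * P + L2HIN : ℕ) : ℤ) : ℝ) ≤ ((2 * lo : ℤ) : ℝ) := by exact_mod_cast hdec
      push_cast at this
      exact this
    have hlo' : (lo : ℝ) ≤ 2 ^ 80 * Real.log n := by
      rw [div_le_iff₀ (by positivity)] at hlo; linarith
    have key : 2 ^ 80 * (2 * psiOneNat n + Real.log 2) ≤ 2 ^ 80 * (2 * Real.log n) := by linarith
    have := le_of_mul_le_mul_left key (by positivity : (0 : ℝ) < 2 ^ 80)
    linarith

/-- Soundness of `tinyRun`. [folklore] -/
theorem tinyRun_sound : ∀ (fuel n P : ℕ), tinyRun fuel n P = true → 2 ^ 80 * psiOneNat n ≤ P →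
    ∀ m : ℕ, n < m → m ≤ n + fuel → 3 ≤ m → psiOneNat m ≤ Real.log m - Real.log 2 / 2
  | 0, n, P, _, _, m, h1, h2, _ => by omega
  | fuel + 1, n, P, hrun, hP, m, h1, h2, h3 => by
    unfold tinyRun at hrun
    revert hrun
    cases hinc : incr (n + 1) with
    | none => simp
    | some d =>
      intro hrun
      simp only [Bool.and_eq_true] at hrun
      obtain ⟨hstep, hrest⟩ := hrun
      have hP' : 2 ^ 80 * psiOneNat (n + 1) ≤ ((P + d : ℕ) : ℝ) := by
        have hi := incr_sound hinc
        rw [psiOneNat_succ, mul_add]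
        push_cast at hi ⊢
        linarith
      rcases Nat.lt_or_ge (n + 1) m with hlt | hge
      · exact tinyRun_sound fuel (n + 1) (P + d) hrest hP' m hlt (by omega) h3
      · have hm : m = n + 1 := by omega
        subst hm
        exact stepOK2_sound h3 hstep hP'

/-- `Σ_{k ≤ N} Λ(k)/k ≤ log N − (log 2)/2` for `3 ≤ N ≤ 19` (kernel computation; the margin is `0.039`
at `N = 3`). [folklore] -/
theorem sum_vonMangoldt_div_le_tiny_nat {N : ℕ} (h3 : 3 ≤ N) (h19 : N ≤ 19) :
    ∑ k ∈ Finset.Icc 1 N, (Λ k : ℝ) / k ≤ Real.log N - Real.log 2 / 2 := by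
  have h0 : 2 ^ 80 * psiOneNat 0 ≤ ((0 : ℕ) : ℝ) := by simp [psiOneNat]
  exact tinyRun_sound 19 0 0 tinyRun_holds h0 N (by omega) (by omega) h3

/-! ### The Mertens gain for all `y ≥ 2` -/

/-- `Σ_{k ≤ 2} Λ(k)/k = (log 2)/2`. [folklore] -/
theorem sum_vonMangoldt_div_two : ∑ k ∈ Finset.Icc 1 2, (Λ k : ℝ) / k = Real.log 2 / 2 := by
  rw [show Finset.Icc 1 2 = {1, 2} by decide, Finset.sum_pair (by norm_num), vonMangoldt_apply_one,
    vonMangoldt_apply_prime Nat.prime_two]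
  push_cast
  ring

/-- **Stub `stub_mertensGain` (STUB-PLAN `stub_windowCore` Phase A; registered on crux
stmt-RiemannHypothesis-11229) — the Mertens gain.** For every real `y ≥ 2`,
`Σ_{n ≤ y} Λ(n)/n ≤ log y − (log 2)/2`, with equality at `y = 2`; i.e. `c(y) = log y − ψ₁(y) ≥ (log 2)/2`
(lead c3, NOTES-c3 §3 (A): `V ≤ Σ ‖a_m‖² (log M − κ_m)`, `κ_m = (log 2)/2` for `m ≤ M/2`). Ranges:
`[2, 3)` exact, `[3, 20)` kernel, `[20, ∞)` from `sum_vonMangoldt_div_le_of_twenty_le` (`γ − 9/100 > (log 2)/2`).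
[cite: RosserSchoenfeld1962, Thm. 6 and Lemma 7] -/
theorem stub_mertensGain : ∀ y : ℝ, 2 ≤ y →
    ∑ n ∈ Finset.Icc 1 ⌊y⌋₊, (ArithmeticFunction.vonMangoldt n : ℝ) / n ≤
      Real.log y - Real.log 2 / 2 := by
  intro y hy
  have hy0 : 0 ≤ y := by linarith
  have hl2 : Real.log 2 ≤ Real.log y := Real.log_le_log (by norm_num) hy
  rcases lt_or_ge y 3 with h3 | h3
  · -- `⌊y⌋ = 2`
    have hfl : ⌊y⌋₊ = 2 := by
      rw [Nat.floor_eq_iff hy0]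
      exact ⟨by exact_mod_cast hy, by norm_num; linarith⟩
    rw [hfl, sum_vonMangoldt_div_two]
    linarith
  rcases lt_or_ge y 20 with h20 | h20
  · have hN3 : 3 ≤ ⌊y⌋₊ := Nat.le_floor (by exact_mod_cast h3)
    have hN19 : ⌊y⌋₊ ≤ 19 := by
      have : ⌊y⌋₊ < 20 := (Nat.floor_lt hy0).2 (by exact_mod_cast h20)
      omega
    have h := sum_vonMangoldt_div_le_tiny_nat hN3 hN19
    have hlog : Real.log (⌊y⌋₊ : ℝ) ≤ Real.log y :=
      Real.log_le_log (by exact_mod_cast (show 0 < ⌊y⌋₊ by omega)) (Nat.floor_le hy0)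
    linarith
  · have h := sum_vonMangoldt_div_le_of_twenty_le h20
    have hγ := Literature.Analysis.SpecialFunctions.Real.eulerMascheroniConstant_gt_d8
    have hlog2 := Real.log_two_lt_d9
    linarith

/-- The Mertens gain over the naturals: `Σ_{n ≤ N} Λ(n)/n ≤ log N − (log 2)/2` for `N ≥ 2`.
[cite: RosserSchoenfeld1962, Thm. 6 and Lemma 7] -/
theorem sum_vonMangoldt_div_le_log_sub_nat {N : ℕ} (hN : 2 ≤ N) :
    ∑ n ∈ Finset.Icc 1 N, (Λ n : ℝ) / n ≤ Real.log N - Real.log 2 / 2 := by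
  have h := stub_mertensGain (N : ℝ) (by exact_mod_cast hN)
  rwa [Nat.floor_natCast] at h

/-! ### A5: the sharp Helson potential, pointwise in the divisor variable -/

/-- **Helson potential with the Mertens gain**: for `1 ≤ m` with `2m ≤ M`,
`log m + Σ_{n ≤ M/m} Λ(n)/n ≤ log M − (log 2)/2`. [folklore] -/
theorem potential_le_of_two_mul_le {M m : ℕ} (hm : 1 ≤ m) (h2 : 2 * m ≤ M) :
    Real.log m + ∑ n ∈ Finset.Icc 1 (M / m), (Λ n : ℝ) / n ≤ Real.log M - Real.log 2 / 2 := by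
  have hq : 2 ≤ M / m := (Nat.le_div_iff_mul_le hm).2 h2
  have h := sum_vonMangoldt_div_le_log_sub_nat hq
  have hm0 : (0 : ℝ) < m := by exact_mod_cast hm
  have hq0 : (0 : ℝ) < ((M / m : ℕ) : ℝ) := by exact_mod_cast (show 0 < M / m by omega)
  have hprod : (m : ℝ) * ((M / m : ℕ) : ℝ) ≤ M := by exact_mod_cast Nat.mul_div_le M m
  have hlog : Real.log m + Real.log ((M / m : ℕ) : ℝ) ≤ Real.log M := by
    rw [← Real.log_mul hm0.ne' hq0.ne']
    exact Real.log_le_log (by positivity) hprod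
  linarith

/-- **Helson potential with the Mertens constant**: for `1 ≤ m` with `20m ≤ M`,
`log m + Σ_{n ≤ M/m} Λ(n)/n ≤ log M − γ + 9/100`. [folklore] -/
theorem potential_le_of_twenty_mul_le {M m : ℕ} (hm : 1 ≤ m) (h20 : 20 * m ≤ M) :
    Real.log m + ∑ n ∈ Finset.Icc 1 (M / m), (Λ n : ℝ) / n ≤
      Real.log M - Real.eulerMascheroniConstant + 9 / 100 := by
  have hq : 20 ≤ M / m := (Nat.le_div_iff_mul_le hm).2 h20
  have h := sum_vonMangoldt_div_le_of_twenty_le_nat hq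
  have hm0 : (0 : ℝ) < m := by exact_mod_cast hm
  have hq0 : (0 : ℝ) < ((M / m : ℕ) : ℝ) := by exact_mod_cast (show 0 < M / m by omega)
  have hprod : (m : ℝ) * ((M / m : ℕ) : ℝ) ≤ M := by exact_mod_cast Nat.mul_div_le M m
  have hlog : Real.log m + Real.log ((M / m : ℕ) : ℝ) ≤ Real.log M := by
    rw [← Real.log_mul hm0.ne' hq0.ne']
    exact Real.log_le_log (by positivity) hprod
  linarith

end Summit.RiemannHypothesis.RiemannHypothesis.Theorems.WeilCombMertensAll
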